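import Summits.RiemannHypothesis.RiemannHypothesis.Theses.WeilSemilocal
import Summits.RiemannHypothesis.RiemannHypothesis.Theorems.SemilocalClassLaw
import HarnessLib

/-!
# Route `WeilSemilocal` — the HEAD support item `SemilocalClassLawHead` (RH-FREE, kernel)

Item stmt-RiemannHypothesis-19397 of `route-RiemannHypothesis-WeilSemilocal`: C-I(a) at every prime `q < 80` — for every prime
`q' > q`, `a*(S_q) = weilSemilocalThreshold (Nat.primesBelow q) < (log q')/2`.  This is VERBATIM the unfolding of
`SemilocalClassLaw.SemilocalClassLawBelow 80`, PROVED in the tree as `SemilocalClassLaw.semilocalClassLawBelow_eighty`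
(p402719 + p405272: the 22 kernel wall certificates `q = 2 … 79`).  One-line closer.  Nothing here bears on the truth of RH
(UPPER clauses of truncated Weil forms only; cell `rh-explicit`, typing lane cc-s2-1 gen21).
-/

set_option linter.dupNamespace false  -- the mandated namespace repeats `RiemannHypothesis`

namespace Summit.RiemannHypothesis.RiemannHypothesis.Theorems.WeilSemilocalRoute

open Summit.RiemannHypothesis.RiemannHypothesis.Theorems

/-- **HEAD of route `WeilSemilocal`** (item stmt-RiemannHypothesis-19397): C-I(a) at every prime `q < 80`, from
`SemilocalClassLaw.semilocalClassLawBelow_eighty`. [this cell; thresholds as in Yoshida 1992 Prop. 6] -/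
theorem semilocalClassLawHead_proof :
    Summit.RiemannHypothesis.RiemannHypothesis.Theses.WeilSemilocal.SemilocalClassLawHead := by
  unfold Theses.WeilSemilocal.SemilocalClassLawHead
  intro q hq h80
  exact SemilocalClassLaw.semilocalClassLawBelow_eighty q hq h80

end Summit.RiemannHypothesis.RiemannHypothesis.Theorems.WeilSemilocalRoute
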